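import Mathlib
import Summits.ValiantsHypothesis.ValiantsHypothesis.Theorems.ValuativeGCTValuativeFlipIsotypicBinomialBound

/-!
# Block-size arithmetic for `GLnSeparatingDesigns.SeparationDegreeCost` (BCGPU 2024, Lemma 2.7,
# counting form)

Crux `stmt-MatrixMultiplication-18361` (route `GLnSeparatingDesigns`), line `SketchIdeator1`, lead's
stub `stub_finrank_irreducible_le` (every irreducible constituent of `ℂ[x_{ij}]_{≤ s}` under right
translation has dimension `≤ s^{n(n-1)/2}`), file 1 of its chain: the pure arithmetic

  `∏_{j<n} C(χ_j + (n-1-j), n-1-j) ≤ s^{n(n-1)/2}`   for `n ≥ 3`, `s ≥ 2`, `Σ_j χ_j ≤ s`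

(`prod_choose_colDegree_le_pow`, registered helper stub). The left-hand side is the number of
exponent vectors on the strictly lower-triangular positions whose column-`j` total is `≤ χ_j`
(column `j` has `n-1-j` positions), which bounds the dimension of the span of the `U⁻`-orbit of a
highest-weight vector of column degrees `χ` (file 2). Proof: if every `χ_j ≤ s-1`, termwise
`C(χ_j + k_j, k_j) ≤ (χ_j + 1)^{k_j} ≤ s^{k_j}` (the tree's `ValuativeFlip.choose_add_le_succ_pow`) with
`Σ_j k_j = n(n-1)/2`; otherwise exactly one
`χ_{j₀} = s` and the others vanish, and `C(s+k, k) ≤ s^{k+1} ≤ s^{n(n-1)/2}` since `k+1 ≤ n ≤ n(n-1)/2`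
for `n ≥ 3`. (Blasiak–Cohn–Grochow–Pratt–Umans 2024, arXiv:2410.14905, Lemma 2.7 bounds the Weyl
dimension by `s^{C(n,2)}`; this counting replacement needs no Weyl formula.)
-/

-- `Summit.MatrixMultiplication.MatrixMultiplication.…` is the tree's mandated summit-side namespace
-- (single-conjunct summit: Sub = Summit), which the `dupNamespace` linter would flag on every decl.
set_option linter.dupNamespace false

open scoped BigOperators

namespace Summit.MatrixMultiplication.MatrixMultiplication.Theorems

/-- `C(s + k, k) ≤ s^{k+1}` for `s ≥ 2`, `k ≥ 1`. -/
theorem choose_add_le_pow_succ {s : ℕ} (hs : 2 ≤ s) :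
    ∀ {k : ℕ}, 1 ≤ k → (s + k).choose k ≤ s ^ (k + 1) := by
  intro k hk
  induction k with
  | zero => omega
  | succ k ih =>
    rcases Nat.eq_zero_or_pos k with rfl | hkpos
    · -- `C(s+1, 1) = s + 1 ≤ s²`
      rw [zero_add, Nat.choose_one_right, pow_two]
      nlinarith
    · have ih' := ih hkpos
      have h1 : (s + k + 1).choose (k + 1) * (k + 1) = (s + k + 1) * (s + k).choose k :=
        (Nat.add_one_mul_choose_eq (s + k) k).symm
      have hsk : s + k + 1 ≤ (k + 1) * s := by nlinarith
      have h2 : (s + k + 1) * (s + k).choose k ≤ (k + 1) * s ^ (k + 1 + 1) := by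
        calc (s + k + 1) * (s + k).choose k ≤ (s + k + 1) * s ^ (k + 1) :=
              Nat.mul_le_mul_left _ ih'
          _ ≤ ((k + 1) * s) * s ^ (k + 1) := Nat.mul_le_mul_right _ hsk
          _ = (k + 1) * s ^ (k + 1 + 1) := by ring
      rw [show s + (k + 1) = s + k + 1 by ring]
      refine Nat.le_of_mul_le_mul_right (c := k + 1) ?_ (Nat.succ_pos k)
      rw [h1]
      linarith [h2]

/-- `Σ_{j<n} (n-1-j) = n(n-1)/2`. -/
theorem sum_sub_one_sub_eq (n : ℕ) : ∑ j : Fin n, (n - 1 - (j : ℕ)) = n * (n - 1) / 2 := by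
  rw [Fin.sum_univ_eq_sum_range (fun j => n - 1 - j) n, Finset.sum_range_reflect (fun i => i) n,
    Finset.sum_range_id]

/-- **The block-size arithmetic** (BCGPU 2024 Lemma 2.7, counting form): for `n ≥ 3`, `s ≥ 2` and
column degrees `χ : Fin n → ℕ` with `Σ χ ≤ s`,
`∏_j C(χ_j + (n-1-j), n-1-j) ≤ s^{n(n-1)/2}`. If all `χ_j ≤ s - 1` this is termwise
`C(χ_j + k_j, k_j) ≤ (χ_j + 1)^{k_j} ≤ s^{k_j}` with `Σ k_j = n(n-1)/2`; otherwise one `χ_{j₀} = s`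
and all other `χ_j = 0`, and `C(s + k, k) ≤ s^{k+1} ≤ s^{n(n-1)/2}` as `k + 1 ≤ n ≤ n(n-1)/2`. -/
theorem prod_choose_colDegree_le_pow {n s : ℕ} (hn : 3 ≤ n) (hs : 2 ≤ s) (χ : Fin n → ℕ)
    (hχ : ∑ j, χ j ≤ s) :
    ∏ j : Fin n, (χ j + (n - 1 - (j : ℕ))).choose (n - 1 - (j : ℕ)) ≤ s ^ (n * (n - 1) / 2) := by
  have hs1 : 1 ≤ s := by omega
  by_cases hA : ∀ j, χ j + 1 ≤ s
  · -- termwise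
    calc ∏ j : Fin n, (χ j + (n - 1 - (j : ℕ))).choose (n - 1 - (j : ℕ))
        ≤ ∏ j : Fin n, s ^ (n - 1 - (j : ℕ)) := by
          refine Finset.prod_le_prod' fun j _ => ?_
          exact (Summit.ValiantsHypothesis.ValiantsHypothesis.Theorems.ValuativeFlip.choose_add_le_succ_pow
            _ _).trans (Nat.pow_le_pow_left (hA j) _)
      _ = s ^ (n * (n - 1) / 2) := by
          rw [Finset.prod_pow_eq_pow_sum, sum_sub_one_sub_eq]
  · push Not at hA
    obtain ⟨j₀, hj₀⟩ := hA
    -- `χ j₀ = s` and the other `χ j` vanish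
    have hsingle : χ j₀ ≤ ∑ j, χ j := Finset.single_le_sum (fun j _ => Nat.zero_le _) (Finset.mem_univ j₀)
    have hχj₀ : χ j₀ = s := by omega
    have hrest : ∀ j, j ≠ j₀ → χ j = 0 := by
      intro j hj
      have h2 : χ j₀ + χ j ≤ ∑ i, χ i := by
        rw [← Finset.sum_pair (Ne.symm hj)]
        exact Finset.sum_le_sum_of_subset_of_nonneg (Finset.subset_univ _) fun _ _ _ => Nat.zero_le _
      omega
    have hprod : ∏ j : Fin n, (χ j + (n - 1 - (j : ℕ))).choose (n - 1 - (j : ℕ)) =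
        (s + (n - 1 - (j₀ : ℕ))).choose (n - 1 - (j₀ : ℕ)) := by
      rw [← Finset.mul_prod_erase _ _ (Finset.mem_univ j₀), hχj₀, Finset.prod_eq_one, mul_one]
      intro j hj
      rw [hrest j (Finset.ne_of_mem_erase hj), zero_add, Nat.choose_self]
    rw [hprod]
    set k := n - 1 - (j₀ : ℕ) with hk
    rcases Nat.eq_zero_or_pos k with hk0 | hkpos
    · rw [hk0, Nat.choose_zero_right]
      exact Nat.one_le_pow _ _ hs1
    · refine (choose_add_le_pow_succ hs hkpos).trans (Nat.pow_le_pow_right hs1 ?_)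
      -- `k + 1 ≤ n ≤ n(n-1)/2`
      have hkn : k + 1 ≤ n := by omega
      have hnn : n ≤ n * (n - 1) / 2 := by
        refine (Nat.le_div_iff_mul_le two_pos).2 ?_
        have : 2 ≤ n - 1 := by omega
        calc n * 2 ≤ n * (n - 1) := Nat.mul_le_mul_left n this
          _ = n * (n - 1) := rfl
      omega


end Summit.MatrixMultiplication.MatrixMultiplication.Theorems
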